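/-
Copyright (c) 2026. All rights reserved.
Released under Apache 2.0 license as described in the file LICENSE.
Authors: abc-iut cell, statement-typer seat abc-iut-L4-t3 (wave 1).
-/
import Literature.AnabelianGeometry.AbsoluteAnabelian.LogFrobeniusTelecoreExtensions
import Literature.AnabelianGeometry.AbsoluteAnabelian.LogFrobeniusContactStructure
import Literature.AnabelianGeometry.AbsoluteAnabelian.LogFrobeniusRigidityProofs

/-!
# [AbsTopIII] Corollary 5.5 (v), last sentence: the shifts EXTEND to self-equivalences of the telecore diagram `D_{An•}`

S. Mochizuki, *Topics in absolute anabelian geometry III: global reconstruction algorithms*,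
J. Math. Sci. Univ. Tokyo 22 (2015) 939–1156 [MochizukiAbsTopIII2015]; locator read on the page: Cor 5.5 (v), last sentence,
p. 132 ("these self-equivalences also extend naturally [cf. the technique of extension applied in Definition 3.5, (vi)] to
the diagram of categories … that constitutes the telecore of (ii) …").

`LogFrobeniusTelecoreExtensions.lean` (this seat) types the sentence as `Cor55ShiftActionTelecore`, with the extended
self-equivalences existentially quantified and pinned by `ExtendsShift`. This file CONSTRUCTS them, for the telecore edges
`J = anTelJ` (`φ_⋏`, `⋏ ∈ L ∪ {□}`) carrying `φ_{An•}` (the shape of this seat's `contactTelecore`): the morphism of oriented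
graphs `telShiftGraph k : Γ⃗_{D_{An•}} → Γ⃗_{D_{An•}}` (the shift `⋎ ↦ ⋎ + k` on the copies of `𝒳`, their arrows `log`,
`id_⋎` and telecore edges `φ_⋎`; the identity elsewhere), the 1-morphism `telShiftOneMorphism k` over it (the identity
functors `L.shiftApp k` / `𝟭 An•[𝒳]`, identity 2-cells by the strict commutation `telShift_comm` — "the technique of
extension applied in Definition 3.5, (vi)"), and PROVES: the group law on graphs (`telShiftGraph_comp`, `telShiftGraph_zero`),
that each `telShiftOneMorphism k` is an EQUIVALENCE of diagrams of categories with quasi-inverse the shift by `-k`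
(`telShiftOneMorphism_isEquivalence`, by abc-iut-L4-t3 gen 2's `OneMorphism.transport_isomorphic`), and that the resulting
self-equivalence `telShiftSelfEquivalence k` extends the shift of `D•⊢` in the sense of `ExtendsShift`
(`telShift_extendsShift`). The compatibility of these self-equivalences with the telecore family `𝔍` and the contact
structure `ℋ_{An•}` (the remaining conjunct of `Cor55ShiftActionTelecore`) is NOT proved here. Pure category theory over
the interface `L`; refereed pre-IUT material; nothing here bears on [IUTchIII] Cor. 3.12.
-/

set_option autoImplicit false

universe u v' w'

open CategoryTheory Quiver

namespace Literature.AnabelianGeometry.AbsoluteAnabelian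

/-- two morphisms of quivers with equal vertex maps and heterogeneously equal arrow maps are equal. [folklore] -/
private theorem Prefunctor.ext_of_heq' {V : Type w'} [Quiver.{v'} V] {F G : V ⥤q V}
    (h_obj : ∀ X, F.obj X = G.obj X) (h_map : ∀ (X Y : V) (f : X ⟶ Y), HEq (F.map f) (G.map f)) : F = G := by
  obtain ⟨Fo, Fm⟩ := F
  obtain ⟨Go, Gm⟩ := G
  obtain rfl : Fo = Go := funext h_obj
  have hm : @Fm = @Gm := by
    funext X Y f
    exact eq_of_heq (h_map X Y f)
  cases hm
  rfl

namespace LogFrobeniusSetting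

open DiagramOfCategories

variable {Vmod : Type u} {isArc : Vmod → Bool} (L : LogFrobeniusSetting Vmod isArc)

/-! ## The shift on the oriented graph `Γ⃗_{D_{An•}}` -/

/-- the shift on the telecore edges: `φ_⋎ ↦ φ_{⋎+k}`, `φ_□ ↦ φ_□`. [cite: MochizukiAbsTopIII2015, Cor 5.5 (v) p. 132] -/
def telIdxShift (k : ℤ) : (x : DVertex Vmod isArc) → TelecoreIdx x → TelecoreIdx (x.shift k)
  | .row1 _, _ => PUnit.unit
  | .core, _ => PUnit.unit
  | .nplus _, j => PEmpty.elim j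
  | .nv _, j => PEmpty.elim j
  | .e5, j => PEmpty.elim j
  | .an, j => PEmpty.elim j
  | .e7, j => PEmpty.elim j
  | .nmonoPlus _, j => PEmpty.elim j
  | .nmono _, j => PEmpty.elim j
  | .emono5, j => PEmpty.elim j
  | .anMono, j => PEmpty.elim j
  | .emono7, j => PEmpty.elim j

/-- the shift on the vertices of `Γ⃗_{D_{An•}}`: `DVertex.shift` on `D•_{≤5}`, the core vertex `An•[𝒳]` fixed.
[cite: MochizukiAbsTopIII2015, Cor 5.5 (v) p. 132] -/
def telShiftObj (k : ℤ) : (anTelecoreShape (Vmod := Vmod) (isArc := isArc) anTelJ).Vertex →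
    (anTelecoreShape (Vmod := Vmod) (isArc := isArc) anTelJ).Vertex
  | ExtVertex.base a => ExtVertex.base ⟨a.1.shift k, inFive_shift k a.2⟩
  | ExtVertex.obs => ExtVertex.obs

/-- the shift on the arrows of `Γ⃗_{D_{An•}}`: `DVertex.shiftHom` on the arrows of `D•_{≤5}` and on the observation edges
`κ_{An•}`, `telIdxShift` on the telecore edges. [cite: MochizukiAbsTopIII2015, Cor 5.5 (v) p. 132] -/
def telShiftMap (k : ℤ) : {a b : (anTelecoreShape (Vmod := Vmod) (isArc := isArc) anTelJ).Vertex} → (a ⟶ b) →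
    (telShiftObj (isArc := isArc) k a ⟶ telShiftObj k b)
  | ExtVertex.base _, ExtVertex.base _, e => DVertex.shiftHom k e
  | ExtVertex.base _, ExtVertex.obs, i => DVertex.shiftHom k i
  | ExtVertex.obs, ExtVertex.base b, j => telIdxShift k b.1 j
  | ExtVertex.obs, ExtVertex.obs, e => PEmpty.elim e

/-- the shift by `k` as a morphism of oriented graphs `Γ⃗_{D_{An•}} → Γ⃗_{D_{An•}}`. [cite: MochizukiAbsTopIII2015, Cor 5.5 (v) p. 132] -/
def telShiftGraph (k : ℤ) : (anTelecoreShape (Vmod := Vmod) (isArc := isArc) anTelJ).Vertex ⥤q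
    (anTelecoreShape (Vmod := Vmod) (isArc := isArc) anTelJ).Vertex where
  obj := telShiftObj k
  map := telShiftMap k

/-- the telecore-edge shift composes according to the group law (heterogeneously). [folklore] -/
private theorem telIdxShift_telIdxShift_heq (k l : ℤ) :
    ∀ (x : DVertex Vmod isArc) (j : TelecoreIdx x),
      HEq (telIdxShift l (x.shift k) (telIdxShift k x j)) (telIdxShift (isArc := isArc) (k + l) x j)
  | .row1 _, _ => HEq.rfl
  | .core, _ => HEq.rfl
  | .nplus _, j => PEmpty.elim j
  | .nv _, j => PEmpty.elim j
  | .e5, j => PEmpty.elim j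
  | .an, j => PEmpty.elim j
  | .e7, j => PEmpty.elim j
  | .nmonoPlus _, j => PEmpty.elim j
  | .nmono _, j => PEmpty.elim j
  | .emono5, j => PEmpty.elim j
  | .anMono, j => PEmpty.elim j
  | .emono7, j => PEmpty.elim j

/-- the telecore-edge shift by `0` is the identity (heterogeneously). [folklore] -/
private theorem telIdxShift_zero_heq :
    ∀ (x : DVertex Vmod isArc) (j : TelecoreIdx x), HEq (telIdxShift (isArc := isArc) 0 x j) j
  | .row1 _, PUnit.unit => HEq.rfl
  | .core, PUnit.unit => HEq.rfl
  | .nplus _, j => PEmpty.elim j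
  | .nv _, j => PEmpty.elim j
  | .e5, j => PEmpty.elim j
  | .an, j => PEmpty.elim j
  | .e7, j => PEmpty.elim j
  | .nmonoPlus _, j => PEmpty.elim j
  | .nmono _, j => PEmpty.elim j
  | .emono5, j => PEmpty.elim j
  | .anMono, j => PEmpty.elim j
  | .emono7, j => PEmpty.elim j

/-- **group law of the shifts of `Γ⃗_{D_{An•}}`**: `shift k` then `shift l` is `shift (k + l)`.
[cite: MochizukiAbsTopIII2015, Cor 5.5 (v) p. 132] -/
theorem telShiftGraph_comp (k l : ℤ) :
    telShiftGraph (Vmod := Vmod) (isArc := isArc) k ⋙q telShiftGraph l = telShiftGraph (k + l) := by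
  refine Prefunctor.ext_of_heq' (fun w => ?_) (fun a b e => ?_)
  · cases w with
    | base a =>
      show ExtVertex.base _ = ExtVertex.base _
      exact congrArg ExtVertex.base (Subtype.ext (DVertex.shift_add k l a.1).symm)
    | obs => rfl
  · cases a with
    | base a =>
      cases b with
      | base b => exact DVertex.shiftHom_shiftHom_heq k l e
      | obs => exact DVertex.shiftHom_shiftHom_heq k l e
    | obs =>
      cases b with
      | base b => exact telIdxShift_telIdxShift_heq k l b.1 e
      | obs => exact PEmpty.elim e

/-- the shift by `0` is the identity morphism of `Γ⃗_{D_{An•}}`. [cite: MochizukiAbsTopIII2015, Cor 5.5 (v) p. 132] -/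
theorem telShiftGraph_zero :
    telShiftGraph (Vmod := Vmod) (isArc := isArc) 0 = 𝟭q (anTelecoreShape (Vmod := Vmod) (isArc := isArc) anTelJ).Vertex := by
  refine Prefunctor.ext_of_heq' (fun w => ?_) (fun a b e => ?_)
  · cases w with
    | base a =>
      show ExtVertex.base _ = ExtVertex.base _
      exact congrArg ExtVertex.base (Subtype.ext (DVertex.shift_zero a.1))
    | obs => rfl
  · cases a with
    | base a =>
      cases b with
      | base b => exact DVertex.shiftHom_zero_heq e
      | obs => exact DVertex.shiftHom_zero_heq e
    | obs =>
      cases b with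
      | base b => exact telIdxShift_zero_heq b.1 e
      | obs => exact PEmpty.elim e

/-! ## The shift as a 1-morphism of `D_{An•}` -/

/-- the functors of the shift: the identity functors (`L.shiftApp` on `D•_{≤5}`, `𝟭` at `An•[𝒳]`).
[cite: MochizukiAbsTopIII2015, Cor 5.5 (v) p. 132] -/
def telShiftApp (k : ℤ) : (w : (anTelecoreShape (Vmod := Vmod) (isArc := isArc) anTelJ).Vertex) →
    ((L.anTelecoreDiagram anTelJ (fun {a} j => L.telecoreFun a.1 j)).obj w ⥤
      (L.anTelecoreDiagram anTelJ (fun {a} j => L.telecoreFun a.1 j)).obj (telShiftObj k w))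
  | ExtVertex.base a => L.shiftApp k a.1
  | ExtVertex.obs => 𝟭 L.An

/-- the telecore functors commute (strictly) with the identity functors of the shift. [folklore] -/
private theorem telecoreFun_shift_comm (k : ℤ) : ∀ (x : DVertex Vmod isArc) (j : TelecoreIdx x),
    𝟭 L.An ⋙ L.telecoreFun (x.shift k) (telIdxShift k x j) = L.telecoreFun x j ⋙ L.shiftApp k x
  | .row1 _, _ => rfl
  | .core, _ => rfl
  | .nplus _, j => PEmpty.elim j
  | .nv _, j => PEmpty.elim j
  | .e5, j => PEmpty.elim j
  | .an, j => PEmpty.elim j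
  | .e7, j => PEmpty.elim j
  | .nmonoPlus _, j => PEmpty.elim j
  | .nmono _, j => PEmpty.elim j
  | .emono5, j => PEmpty.elim j
  | .anMono, j => PEmpty.elim j
  | .emono7, j => PEmpty.elim j

/-- the shift commutes (strictly) with the functors of `D_{An•}`. [cite: MochizukiAbsTopIII2015, Cor 5.5 (v) p. 132] -/
theorem telShift_comm (k : ℤ) {a b : (anTelecoreShape (Vmod := Vmod) (isArc := isArc) anTelJ).Vertex} (e : a ⟶ b) :
    L.telShiftApp k a ⋙ (L.anTelecoreDiagram anTelJ (fun {a} j => L.telecoreFun a.1 j)).map (telShiftMap k e) =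
      (L.anTelecoreDiagram anTelJ (fun {a} j => L.telecoreFun a.1 j)).map e ⋙ L.telShiftApp k b := by
  cases a with
  | base a =>
    cases b with
    | base b => exact L.shift_comm k e
    | obs => exact L.shift_comm k e
  | obs =>
    cases b with
    | base b => exact L.telecoreFun_shift_comm k b.1 e
    | obs => exact PEmpty.elim e

/-- **the shift by `k` as a 1-morphism of diagrams of categories `D_{An•} → D_{An•}`** (Def 3.5 (v)) over `telShiftGraph k`:
identity functors at the vertices, identity 2-cells (by the strict commutation `telShift_comm`) at the arrows — the
"technique of extension applied in Definition 3.5, (vi)". [cite: MochizukiAbsTopIII2015, Cor 5.5 (v) p. 132] -/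
def telShiftOneMorphism (k : ℤ) :
    OneMorphism (telShiftGraph k) (L.anTelecoreDiagram anTelJ (fun {a} j => L.telecoreFun a.1 j))
      (L.anTelecoreDiagram anTelJ (fun {a} j => L.telecoreFun a.1 j)) where
  app := L.telShiftApp k
  iso e := eqToIso (L.telShift_comm k e)

/-! ## The shifts of `D_{An•}` are equivalences of diagrams of categories -/

/-- the vertex functors of the shift are identity functors (heterogeneously). [cite: MochizukiAbsTopIII2015, Cor 5.5 (v) p. 132] -/
theorem telShiftApp_heq_id (k : ℤ) (w : (anTelecoreShape (Vmod := Vmod) (isArc := isArc) anTelJ).Vertex) :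
    HEq (L.telShiftApp k w) (𝟭 ((L.anTelecoreDiagram anTelJ (fun {a} j => L.telecoreFun a.1 j)).obj w)) := by
  cases w with
  | base a => exact L.shiftApp_heq_id k a.1
  | obs => exact HEq.rfl

/-- the vertex functors of a composite of two shifts are identity functors (heterogeneously). [cite: MochizukiAbsTopIII2015, Cor 5.5 (v) p. 132] -/
theorem telShiftApp_comp_heq_id (k l : ℤ) (w : (anTelecoreShape (Vmod := Vmod) (isArc := isArc) anTelJ).Vertex) :
    HEq (L.telShiftApp k w ⋙ L.telShiftApp l (telShiftObj k w))
      (𝟭 ((L.anTelecoreDiagram anTelJ (fun {a} j => L.telecoreFun a.1 j)).obj w)) := by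
  cases w with
  | base a => exact L.shiftApp_comp_heq_id k l a.1
  | obs => exact HEq.rfl

section EqToHomCalculus

variable {C : Type (u + 1)} [Category.{u} C] {C' : Type (u + 1)} [Category.{u} C']

/-- an identity is an `eqToHom`. [folklore] -/
private theorem exists_eq_eqToHom_id' (X : C) : ∃ h : X = X, 𝟙 X = eqToHom h := ⟨rfl, rfl⟩

/-- a composite of two `eqToHom`s is an `eqToHom`. [folklore] -/
private theorem exists_eq_eqToHom_comp' {X Y Z : C} {f : X ⟶ Y} {g : Y ⟶ Z} (hf : ∃ h, f = eqToHom h)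
    (hg : ∃ h, g = eqToHom h) : ∃ h, f ≫ g = eqToHom h := by
  obtain ⟨p, rfl⟩ := hf
  obtain ⟨q, rfl⟩ := hg
  exact ⟨p.trans q, eqToHom_trans p q⟩

/-- a functor maps an `eqToHom` to an `eqToHom`. [folklore] -/
private theorem exists_eq_eqToHom_map' (F : C ⥤ C') {X Y : C} {f : X ⟶ Y} (hf : ∃ h, f = eqToHom h) :
    ∃ h, F.map f = eqToHom h := by
  obtain ⟨p, rfl⟩ := hf
  exact ⟨congrArg F.obj p, eqToHom_map F p⟩

/-- a component of an `eqToHom` between functors is an `eqToHom`. [folklore] -/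
private theorem exists_eq_eqToHom_app' {F G : C ⥤ C'} {α : F ⟶ G} (hα : ∃ h, α = eqToHom h) (X : C) :
    ∃ h, α.app X = eqToHom h := by
  obtain ⟨p, rfl⟩ := hα
  exact ⟨Functor.congr_obj p X, eqToHom_app p X⟩

/-- two `eqToHom`s with the same source and target are equal. [folklore] -/
private theorem eq_of_exists_eq_eqToHom' {X Y : C} {f g : X ⟶ Y} (hf : ∃ h, f = eqToHom h)
    (hg : ∃ h, g = eqToHom h) : f = g := by
  obtain ⟨p, rfl⟩ := hf
  obtain ⟨q, rfl⟩ := hg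
  rfl

end EqToHomCalculus

/-- the edge 2-cells of a shift are `eqToIso`s (by construction). [cite: MochizukiAbsTopIII2015, Cor 5.5 (v) p. 132] -/
theorem telShiftOneMorphism_iso_eq (k : ℤ) {a b : (anTelecoreShape (Vmod := Vmod) (isArc := isArc) anTelJ).Vertex}
    (e : a ⟶ b) : ∃ H, (L.telShiftOneMorphism k).iso e = eqToIso H :=
  ⟨L.telShift_comm k e, rfl⟩

/-- the composite of two shifts commutes strictly with the functors of `D_{An•}`. [cite: MochizukiAbsTopIII2015, Cor 5.5 (v) p. 132] -/
theorem telShift_comp_comm (k l : ℤ) {a b : (anTelecoreShape (Vmod := Vmod) (isArc := isArc) anTelJ).Vertex} (e : a ⟶ b) :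
    (L.telShiftApp k a ⋙ L.telShiftApp l (telShiftObj k a)) ⋙
        (L.anTelecoreDiagram anTelJ (fun {a} j => L.telecoreFun a.1 j)).map (telShiftMap l (telShiftMap k e)) =
      (L.anTelecoreDiagram anTelJ (fun {a} j => L.telecoreFun a.1 j)).map e ⋙
        (L.telShiftApp k b ⋙ L.telShiftApp l (telShiftObj k b)) := by
  rw [Functor.assoc, L.telShift_comm l (telShiftMap k e), ← Functor.assoc, L.telShift_comm k e, Functor.assoc]

/-- the edge 2-cells of a composite of two shifts are `eqToIso`s. [cite: MochizukiAbsTopIII2015, Cor 5.5 (v) p. 132] -/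
theorem telShiftOneMorphism_comp_iso_eq (k l : ℤ)
    {a b : (anTelecoreShape (Vmod := Vmod) (isArc := isArc) anTelJ).Vertex} (e : a ⟶ b) :
    ∃ H, ((L.telShiftOneMorphism k).comp (L.telShiftOneMorphism l)).iso e = eqToIso H := by
  have H := L.telShift_comp_comm k l e
  refine ⟨H, ?_⟩
  ext x
  refine eq_of_exists_eq_eqToHom' ?_ (exists_eq_eqToHom_app' (α := (eqToIso H).hom) ⟨H, eqToIso.hom H⟩ x)
  exact exists_eq_eqToHom_comp' (exists_eq_eqToHom_id' _)
    (exists_eq_eqToHom_comp'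
      (exists_eq_eqToHom_app' (α := eqToHom (L.telShift_comm l (telShiftMap k e)))
        ⟨L.telShift_comm l (telShiftMap k e), rfl⟩ _)
      (exists_eq_eqToHom_comp' (exists_eq_eqToHom_id' _)
        (exists_eq_eqToHom_comp'
          (exists_eq_eqToHom_map' _ (exists_eq_eqToHom_app' (α := eqToHom (L.telShift_comm k e))
            ⟨L.telShift_comm k e, rfl⟩ x))
          (exists_eq_eqToHom_id' _))))

/-- **the shifts of `D_{An•}` are equivalences of diagrams of categories** (Def 3.5 (v)), with quasi-inverse the shift by
`-k`. [cite: MochizukiAbsTopIII2015, Cor 5.5 (v) p. 132] -/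
theorem telShiftOneMorphism_isEquivalence (k : ℤ) : (L.telShiftOneMorphism k).IsEquivalence := by
  have h₁ : telShiftGraph (Vmod := Vmod) (isArc := isArc) k ⋙q telShiftGraph (-k) = 𝟭q _ := by
    rw [telShiftGraph_comp, Int.add_right_neg, telShiftGraph_zero]
  have h₂ : telShiftGraph (Vmod := Vmod) (isArc := isArc) (-k) ⋙q telShiftGraph k = 𝟭q _ := by
    rw [telShiftGraph_comp, Int.add_left_neg, telShiftGraph_zero]
  refine ⟨telShiftGraph (-k), L.telShiftOneMorphism (-k), h₁, h₂, ?_, ?_⟩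
  · exact OneMorphism.transport_isomorphic _ _ _ (fun w => L.telShiftApp_comp_heq_id k (-k) w)
      (fun e => L.telShiftOneMorphism_comp_iso_eq k (-k) e) (fun e => OneMorphism.id_iso_eq_eqToIso e)
  · exact OneMorphism.transport_isomorphic _ _ _ (fun w => L.telShiftApp_comp_heq_id (-k) k w)
      (fun e => L.telShiftOneMorphism_comp_iso_eq (-k) k e) (fun e => OneMorphism.id_iso_eq_eqToIso e)

/-- **the shift by `k` as a self-equivalence of `D_{An•}`** (Def 3.5 (v)). [cite: MochizukiAbsTopIII2015, Cor 5.5 (v) p. 132] -/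
def telShiftSelfEquivalence (k : ℤ) : (L.anTelecoreDiagram anTelJ (fun {a} j => L.telecoreFun a.1 j)).SelfEquivalence :=
  ⟨telShiftGraph k, L.telShiftOneMorphism k, L.telShiftOneMorphism_isEquivalence k⟩

/-- **the self-equivalences EXTEND the shifts of `D•⊢`** (`ExtendsShift`: the same map on the vertices and arrows of
`D•_{≤5}`, the same identity functors `L.shiftApp k` there, the identity at `An•[𝒳]`).
[cite: MochizukiAbsTopIII2015, Cor 5.5 (v) p. 132] -/
theorem telShift_extendsShift (k : ℤ) : L.ExtendsShift k (L.telShiftSelfEquivalence k) :=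
  ⟨fun _ => ⟨rfl, HEq.rfl⟩, fun _ => HEq.rfl, rfl, HEq.rfl⟩

end LogFrobeniusSetting

end Literature.AnabelianGeometry.AbsoluteAnabelian
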